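import Summits.Ventures.CertifiedManyBodySolver.Upper.IntervalReaderLimbKappa
import HarnessLib

/-!
# Ventures/CertifiedManyBodySolver — Upper/IntervalReaderLimbRowSum.lean: the limb backend's `κ` input is an
upper bound (Theorem H1′, part 28)

HONEST FRAMING: first certified bounds; not a superconductivity verdict; every number certified (two
readers) or labelled float.  This file is about A READER'S OWN ARITHMETIC (`l3core/limb.py`,
`max_abs_rowsum_upper`, binary of record `l3core 0.6.9` 5fda02e5cf27520d, the same substrate under
`l3core-sgf 0.1.11`) and says nothing about the Hubbard model, a producer, a row, or the thermodynamic limit.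

`max_abs_rowsum_upper(M)`: `f = np.abs(to_float(M))`; `rs = f.sum(axis=1).max()`; `return int(rs)` when
`K ≤ 2 ∧ n ≤ KMAX_INNER` («exact: entries < 2^40 are exact floats and <= 8192 of them sum exactly»), else
`return int(rs·(1 + 2^−30)) + 2` («float64 evaluation + rigorous slack»).  Its value is the `κ` of `gram_kappas`
on the limb backend = the row-sum hypothesis `∀ i, Σ_j ‖G i j‖ ≤ κ` of parts 2 / 12 (precision P2 of ref-2c g25,
HOME INBOX l.25154: «an undischarged `_hκ` input»).  With part 27's entrywise analysis this part DERIVES it: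
* §D **`EvalTree.rounded_ge_of_leaves`**: a sum of `n` NONNEGATIVE leaves, each `0` or `≥ 1`, evaluated in ANY
  bracketing (part 25's `EvalTree`, every node rounded, `n·2^−53 ≤ 1/2`) is `≥ (1 − n·2^−53)·(exact sum)`, and
  is `0` when the exact sum is (the lower half of the usual `γ_n` bound; `numpy`'s pairwise `sum` included);
* §E `absFloat` / `rowSumMax` / **`maxAbsRowSumUpper`** (the general branch, every operation rounded, the row sums
  in arbitrary per-row bracketings `T a`) and **`row_sum_le_maxAbsRowSumUpper`**: for a limb stack whose lower
  limbs lie in `[0, 2^W)` and with `#cols + 3K ≤ 2^22`, EVERY exact absolute row sum `Σ_b |M a b|` is `≤` the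
  returned integer; `maxAbsRowSumSmall` (the exact branch) and **`row_sum_le_maxAbsRowSumSmall`** (`K ≤ 2`, top
  limb in `[−2^W, 2^W)`, `#cols ≤ KMAX_INNER`: everything is exact, part 25's `rounded_eq_exact_of_int`).
So the limb backend's `κ` satisfies parts 2 / 12's hypothesis under the premises (A1) `rd` fixes the integers of
modulus `≤ 2^53` and (A2) the standard model `|rd x − x| ≤ 2^−53·|x|` on `|x| ≥ 1/2` — hypotheses on the
machine's binary64 arithmetic, never axioms; scope `#cols + 3K ≤ 2^22` (of record: `K ≤ 22`, `n ≤ 8192`).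
Outside the model, as in part 27: overflow (`to_float` = `inf` from 52 limbs on ⇒ `int(inf)` raises — an error
row, never a verdict); `np.abs` / `max` are exact and are not rounded here.
-/

noncomputable section

open Matrix Finset

namespace Summit.Ventures.CertifiedManyBodySolver.Upper.IntervalReader

/-! ## §D  Rounded sums of nonnegative leaves in any bracketing -/

namespace EvalTree
variable {ι : Type*}

/-- Every evaluation tree reads at least one leaf. -/
theorem one_le_card_leaves : ∀ t : EvalTree ι, 1 ≤ Multiset.card t.leaves
  | leaf l => by simp [leaves]
  | add a b => by simp only [leaves, Multiset.card_add]; exact le_add_right (one_le_card_leaves a)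
  | fma l t => by simp [leaves]

/-- Nonnegative leaves give nonnegative exact node values. -/
theorem exact_nonneg (f : ι → ℝ) (hf : ∀ l, 0 ≤ f l) : ∀ t : EvalTree ι, 0 ≤ t.exact f
  | leaf l => hf l
  | add a b => add_nonneg (exact_nonneg f hf a) (exact_nonneg f hf b)
  | fma l t => add_nonneg (hf l) (exact_nonneg f hf t)

/-- Leaves that are `0` or `≥ 1` give exact node values that are `0` or `≥ 1`. -/
theorem exact_zero_or_one_le (f : ι → ℝ) (hf : ∀ l, f l = 0 ∨ 1 ≤ f l) :
    ∀ t : EvalTree ι, t.exact f = 0 ∨ 1 ≤ t.exact f := by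
  have hf0 : ∀ l, 0 ≤ f l := fun l => by rcases hf l with h | h <;> linarith
  intro t
  induction t with
  | leaf l => exact hf l
  | add a b iha ihb =>
      simp only [exact]
      have ha := exact_nonneg f hf0 a; have hb := exact_nonneg f hf0 b
      rcases iha with h | h <;> rcases ihb with h' | h'
      · left; linarith
      all_goals right; linarith
  | fma l t ih =>
      simp only [exact]
      have ht := exact_nonneg f hf0 t
      rcases hf l with h | h <;> rcases ih with h' | h'
      · left; linarith
      all_goals right; linarith

/-- **One rounded node.**  Two nonnegative sub-results `A ≥ (1 − c_a·u)·e_a`, `B ≥ (1 − c_b·u)·e_b` over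
`c_a, c_b ≥ 1` leaves with `(c_a + c_b)·u ≤ 1/2` and `e_a + e_b ≥ 1`: `rd (A + B) ≥ (1 − (c_a + c_b)·u)·(e_a + e_b)`
(`u = 2^−53`). -/
theorem node_rounded_ge {rd : ℝ → ℝ}
    (hsm : ∀ x : ℝ, 1 / 2 ≤ |x| → |rd x - x| ≤ |x| / 2 ^ 53)
    {A B ea eb ca cb : ℝ} (hca : 1 ≤ ca) (hcb : 1 ≤ cb) (hc : (ca + cb) / 2 ^ 53 ≤ 1 / 2)
    (hea : 0 ≤ ea) (heb : 0 ≤ eb) (he : 1 ≤ ea + eb)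
    (hA : (1 - ca / 2 ^ 53) * ea ≤ A) (hB : (1 - cb / 2 ^ 53) * eb ≤ B) :
    (1 - (ca + cb) / 2 ^ 53) * (ea + eb) ≤ rd (A + B) := by
  have h1 : (1 - (ca + cb - 1) / 2 ^ 53) * (ea + eb) ≤ A + B := by
    have hA' : (1 - (ca + cb - 1) / 2 ^ 53) * ea ≤ (1 - ca / 2 ^ 53) * ea :=
      mul_le_mul_of_nonneg_right (by linarith) hea
    have hB' : (1 - (ca + cb - 1) / 2 ^ 53) * eb ≤ (1 - cb / 2 ^ 53) * eb :=
      mul_le_mul_of_nonneg_right (by linarith) heb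
    linarith
  have hhalf : 1 / 2 ≤ A + B := by
    have : (1 : ℝ) - (ca + cb - 1) / 2 ^ 53 ≤ (1 - (ca + cb - 1) / 2 ^ 53) * (ea + eb) := by
      have h0 : (0 : ℝ) ≤ 1 - (ca + cb - 1) / 2 ^ 53 := by linarith
      nlinarith
    linarith
  have hpos : 0 ≤ A + B := by linarith
  have hr : (A + B) - (A + B) / 2 ^ 53 ≤ rd (A + B) := by
    have := hsm (A + B) (by rwa [abs_of_nonneg hpos])
    rw [abs_of_nonneg hpos] at this
    have := (abs_sub_le_iff.mp this).2
    linarith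
  have h2 : (1 - (ca + cb) / 2 ^ 53) * (ea + eb)
      ≤ (1 - 1 / 2 ^ 53) * ((1 - (ca + cb - 1) / 2 ^ 53) * (ea + eb)) := by
    rw [← mul_assoc]
    refine mul_le_mul_of_nonneg_right ?_ (by linarith)
    nlinarith
  calc (1 - (ca + cb) / 2 ^ 53) * (ea + eb)
      ≤ (1 - 1 / 2 ^ 53) * ((1 - (ca + cb - 1) / 2 ^ 53) * (ea + eb)) := h2
    _ ≤ (1 - 1 / 2 ^ 53) * (A + B) := mul_le_mul_of_nonneg_left h1 (by norm_num)
    _ = (A + B) - (A + B) / 2 ^ 53 := by ring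
    _ ≤ rd (A + B) := hr

/-- **Rounded sums of nonnegative leaves, any bracketing.**  Under (A2) and `rd 0 = 0`, leaves that are each `0`
or `≥ 1`, and `n·2^−53 ≤ 1/2` for the leaf count `n`: the rounded evaluation is `0` when the exact sum is, and is
always `≥ (1 − n·2^−53)·(exact sum)` — for EVERY summation order. -/
theorem rounded_ge_of_leaves {rd : ℝ → ℝ}
    (hsm : ∀ x : ℝ, 1 / 2 ≤ |x| → |rd x - x| ≤ |x| / 2 ^ 53) (h0 : rd 0 = 0)
    (f : ι → ℝ) (hf : ∀ l, f l = 0 ∨ 1 ≤ f l) :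
    ∀ t : EvalTree ι, (Multiset.card t.leaves : ℝ) / 2 ^ 53 ≤ 1 / 2 →
      (t.exact f = 0 → t.rounded rd f = 0) ∧
        (1 - (Multiset.card t.leaves : ℝ) / 2 ^ 53) * t.exact f ≤ t.rounded rd f := by
  have hf0 : ∀ l, 0 ≤ f l := fun l => by rcases hf l with h | h <;> linarith
  have hleaf : ∀ l, (1 - 1 / 2 ^ 53) * f l ≤ rd (f l) := fun l => by
    rcases hf l with h | h
    · simp [h, h0]
    · have hpos : 0 ≤ f l := by linarith
      have := hsm (f l) (by rw [abs_of_nonneg hpos]; linarith)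
      rw [abs_of_nonneg hpos] at this
      have := (abs_sub_le_iff.mp this).2
      linarith
  intro t
  induction t with
  | leaf l =>
      intro _
      simp only [exact, rounded, leaves, Multiset.card_singleton, Nat.cast_one]
      exact ⟨fun h => by rw [h, h0], hleaf l⟩
  | add a b iha ihb =>
      intro hc
      simp only [leaves, Multiset.card_add, Nat.cast_add] at hc ⊢
      simp only [exact, rounded]
      have hca : (1 : ℝ) ≤ Multiset.card a.leaves := by exact_mod_cast one_le_card_leaves a
      have hcb : (1 : ℝ) ≤ Multiset.card b.leaves := by exact_mod_cast one_le_card_leaves b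
      obtain ⟨ha0, ha1⟩ := iha (by linarith)
      obtain ⟨hb0, hb1⟩ := ihb (by linarith)
      have hea := exact_nonneg f hf0 a; have heb := exact_nonneg f hf0 b
      have hzero : a.exact f + b.exact f = 0 → rd (a.rounded rd f + b.rounded rd f) = 0 := fun h => by
        rw [ha0 (by linarith), hb0 (by linarith), add_zero, h0]
      refine ⟨hzero, ?_⟩
      rcases exact_zero_or_one_le f hf (add a b) with h | h
      · simp only [exact] at h; rw [h, hzero h, mul_zero]
      · simp only [exact] at h
        exact node_rounded_ge hsm hca hcb hc hea heb h ha1 hb1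
  | fma l t ih =>
      intro hc
      simp only [leaves, Multiset.card_add, Multiset.card_singleton, Nat.cast_add, Nat.cast_one] at hc ⊢
      simp only [exact, rounded]
      have hct : (1 : ℝ) ≤ Multiset.card t.leaves := by exact_mod_cast one_le_card_leaves t
      obtain ⟨ht0, ht1⟩ := ih (by linarith)
      have het := exact_nonneg f hf0 t
      have hzero : f l + t.exact f = 0 → rd (f l + t.rounded rd f) = 0 := fun h => by
        rw [ht0 (by linarith [hf0 l]), add_zero, show f l = 0 by linarith [hf0 l], h0]
      refine ⟨hzero, ?_⟩
      rcases exact_zero_or_one_le f hf (fma l t) with h | h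
      · simp only [exact] at h; rw [h, hzero h, mul_zero]
      · simp only [exact] at h
        have hA : (1 - 1 / 2 ^ 53) * f l ≤ f l := by nlinarith [hf0 l]
        exact node_rounded_ge hsm le_rfl hct hc (hf0 l) het h hA ht1

end EvalTree

/-! ## §E  `max_abs_rowsum_upper`: the returned integer dominates every exact absolute row sum -/

variable {μ ν : Type*} [Fintype μ] [Fintype ν] [Nonempty μ]

/-- `f = np.abs(to_float(M))`, one entry (`np.abs` is exact). -/
def absFloat (rd : ℝ → ℝ) {K : ℕ} (L : Fin K → Matrix μ ν ℤ) (a : μ) (b : ν) : ℝ :=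
  |hornerRd rd (fun i => L i a b)|

/-- `rs = f.sum(axis=1).max()`: row `a` summed along the evaluation tree `T a` (every node rounded), then the
exact maximum over the rows. -/
def rowSumMax (rd : ℝ → ℝ) {K : ℕ} (L : Fin K → Matrix μ ν ℤ) (T : μ → EvalTree ν) : ℝ :=
  Finset.univ.sup' Finset.univ_nonempty fun a => (T a).rounded rd (absFloat rd L a)

/-- The general branch: `int(rs * (1.0 + 2.0 ** -30)) + 2` (the product rounded; `int` truncates a nonnegative
float, i.e. takes the floor). -/
def maxAbsRowSumUpper (rd : ℝ → ℝ) {K : ℕ} (L : Fin K → Matrix μ ν ℤ) (T : μ → EvalTree ν) : ℤ :=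
  ⌊rd (rowSumMax rd L T * (1 + 1 / 2 ^ 30))⌋ + 2

/-- The exact branch (`K ≤ 2 ∧ n ≤ KMAX_INNER`): `int(rs)`. -/
def maxAbsRowSumSmall (rd : ℝ → ℝ) {K : ℕ} (L : Fin K → Matrix μ ν ℤ) (T : μ → EvalTree ν) : ℤ :=
  ⌊rowSumMax rd L T⌋

/-- **`max_abs_rowsum_upper` IS an upper bound (general branch).**  Under (A1)/(A2), for a limb stack `L` whose
lower limbs lie in `[0, 2^W)` (`limb.py` normal form), row sums in ANY per-row bracketing `T a` reading every
column once, and `#cols + 3K ≤ 2^22`: every exact absolute row sum of `M = limbMatVal L` is `≤` the returned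
integer — the `κ` hypothesis of parts 2 / 12 for the limb backend. -/
theorem row_sum_le_maxAbsRowSumUpper {rd : ℝ → ℝ}
    (hsm : ∀ x : ℝ, 1 / 2 ≤ |x| → |rd x - x| ≤ |x| / 2 ^ 53)
    (hint : ∀ z : ℤ, |z| ≤ 2 ^ 53 → rd (z : ℝ) = z)
    {K : ℕ} (L : Fin K → Matrix μ ν ℤ)
    (hlow : ∀ i : Fin K, (i : ℕ) + 1 < K → ∀ a b, 0 ≤ L i a b ∧ L i a b < 2 ^ limbWidth)
    (T : μ → EvalTree ν) (hT : ∀ a, (T a).leaves = Finset.univ.val)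
    (hsize : (Fintype.card ν : ℝ) + 3 * K ≤ 2 ^ 22) (a : μ) :
    ∑ b, |((limbMatVal L a b : ℤ) : ℝ)| ≤ (maxAbsRowSumUpper rd L T : ℝ) := by
  have h0 : rd 0 = 0 := by simpa using hint 0 (by norm_num)
  have hKnn : (0 : ℝ) ≤ K := Nat.cast_nonneg K
  have hnnn : (0 : ℝ) ≤ Fintype.card ν := Nat.cast_nonneg _
  have hK : 3 * (K : ℝ) / 2 ^ 53 ≤ 1 / 2 ^ 30 :=
    calc 3 * (K : ℝ) / 2 ^ 53 ≤ 2 ^ 22 / 2 ^ 53 := by gcongr; linarith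
      _ ≤ 1 / 2 ^ 30 := by norm_num
  have hn : (Fintype.card ν : ℝ) / 2 ^ 53 ≤ 1 / 2 :=
    calc (Fintype.card ν : ℝ) / 2 ^ 53 ≤ 2 ^ 22 / 2 ^ 53 := by gcongr; linarith
      _ ≤ 1 / 2 := by norm_num
  -- every entry, every row (part 27)
  have hent : ∀ a' b, (1 - 3 * (K : ℝ) / 2 ^ 53) * |((limbMatVal L a' b : ℤ) : ℝ)| ≤ absFloat rd L a' b ∧
      (absFloat rd L a' b = 0 ∨ 1 ≤ absFloat rd L a' b) := fun a' b => by
    rw [limbMatVal_apply]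
    exact abs_hornerRd_ge hsm hint (fun i => L i a' b) (fun i hi => hlow i hi a' b) hK
  -- every row sum (§D)
  have hcard : ∀ a', (Multiset.card (T a').leaves : ℝ) = Fintype.card ν := fun a' => by
    rw [hT a']; simp
  have hrow : ∀ a', ((T a').exact (absFloat rd L a') = 0 → (T a').rounded rd (absFloat rd L a') = 0) ∧
      (1 - (Fintype.card ν : ℝ) / 2 ^ 53) * (T a').exact (absFloat rd L a')
        ≤ (T a').rounded rd (absFloat rd L a') := fun a' => by
    have := EvalTree.rounded_ge_of_leaves hsm h0 (absFloat rd L a') (fun b => (hent a' b).2) (T a')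
      (by rw [hcard]; exact hn)
    rwa [hcard] at this
  have hexact : ∀ a', (T a').exact (absFloat rd L a') = ∑ b, absFloat rd L a' b := fun a' =>
    EvalTree.exact_eq_sum _ (hT a')
  -- this row: (1 - 3K u) S ≤ F, (1 - n u) F ≤ R ≤ rs
  have hS0 : 0 ≤ ∑ b, |((limbMatVal L a b : ℤ) : ℝ)| := Finset.sum_nonneg fun b _ => abs_nonneg _
  have hSF : (1 - 3 * (K : ℝ) / 2 ^ 53) * ∑ b, |((limbMatVal L a b : ℤ) : ℝ)| ≤ ∑ b, absFloat rd L a b := by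
    rw [Finset.mul_sum]
    exact Finset.sum_le_sum fun b _ => (hent a b).1
  have hFR : (1 - (Fintype.card ν : ℝ) / 2 ^ 53) * ∑ b, absFloat rd L a b
      ≤ (T a).rounded rd (absFloat rd L a) := by
    rw [← hexact a]; exact (hrow a).2
  have hRrs : (T a).rounded rd (absFloat rd L a) ≤ rowSumMax rd L T :=
    Finset.le_sup' (fun a' => (T a').rounded rd (absFloat rd L a')) (Finset.mem_univ a)
  -- rs is 0 or ≥ 1/2 (it is one of the row sums, whose exact values are 0 or ≥ 1)
  have hrs : rowSumMax rd L T = 0 ∨ 1 / 2 ≤ rowSumMax rd L T := by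
    obtain ⟨a₁, _, ha₁⟩ := Finset.exists_mem_eq_sup' Finset.univ_nonempty
      (fun a' => (T a').rounded rd (absFloat rd L a'))
    have hrs₁ : rowSumMax rd L T = (T a₁).rounded rd (absFloat rd L a₁) := ha₁
    rw [hrs₁]
    rcases EvalTree.exact_zero_or_one_le (absFloat rd L a₁) (fun b => (hent a₁ b).2) (T a₁) with he | he
    · exact Or.inl ((hrow a₁).1 he)
    · right
      calc (1 : ℝ) / 2 = 1 / 2 * 1 := by ring
        _ ≤ (1 - (Fintype.card ν : ℝ) / 2 ^ 53) * (T a₁).exact (absFloat rd L a₁) :=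
            mul_le_mul (by linarith) he (by norm_num) (by linarith)
        _ ≤ (T a₁).rounded rd (absFloat rd L a₁) := (hrow a₁).2
  -- the last two operations: w = rs·(1 + 2^-30) (rounded), then floor + 2
  obtain ⟨w, hw⟩ : ∃ w : ℝ, rowSumMax rd L T * (1 + 1 / 2 ^ 30) = w := ⟨_, rfl⟩
  have hcast : (maxAbsRowSumUpper rd L T : ℝ) = (⌊rd w⌋ : ℝ) + 2 := by
    simp only [maxAbsRowSumUpper, hw]; push_cast; ring
  rw [hcast]
  have hE : (1 - 1 / 2 ^ 53) * w ≤ rd w := by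
    rcases hrs with hz | hh
    · have hw0 : w = 0 := by rw [← hw, hz, zero_mul]
      rw [hw0, h0]; norm_num
    · have hwh : 1 / 2 ≤ w := by
        have : rowSumMax rd L T ≤ w := by rw [← hw]; nlinarith
        linarith
      have hwnn : 0 ≤ w := by linarith
      have := hsm w (by rw [abs_of_nonneg hwnn]; exact hwh)
      rw [abs_of_nonneg hwnn] at this
      have := (abs_sub_le_iff.mp this).2
      linarith
  -- the slack covers the accumulated relative error
  have hprod : (1 : ℝ) ≤ (1 - 1 / 2 ^ 53) * (1 + 1 / 2 ^ 30)
      * ((1 - (Fintype.card ν : ℝ) / 2 ^ 53) * (1 - 3 * (K : ℝ) / 2 ^ 53)) := by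
    have hx : (Fintype.card ν : ℝ) / 2 ^ 53 + 3 * (K : ℝ) / 2 ^ 53 ≤ 2 ^ 22 / 2 ^ 53 := by
      rw [← add_div]; gcongr
    have hp : (0 : ℝ) ≤ (Fintype.card ν : ℝ) / 2 ^ 53 := by positivity
    have hq : (0 : ℝ) ≤ 3 * (K : ℝ) / 2 ^ 53 := by positivity
    have hpq : 1 - ((Fintype.card ν : ℝ) / 2 ^ 53 + 3 * (K : ℝ) / 2 ^ 53)
        ≤ (1 - (Fintype.card ν : ℝ) / 2 ^ 53) * (1 - 3 * (K : ℝ) / 2 ^ 53) := by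
      nlinarith [mul_nonneg hp hq]
    have hnum : (1 : ℝ) ≤ (1 - 1 / 2 ^ 53) * (1 + 1 / 2 ^ 30) * (1 - 2 ^ 22 / 2 ^ 53) := by norm_num
    calc (1 : ℝ) ≤ (1 - 1 / 2 ^ 53) * (1 + 1 / 2 ^ 30) * (1 - 2 ^ 22 / 2 ^ 53) := hnum
      _ ≤ (1 - 1 / 2 ^ 53) * (1 + 1 / 2 ^ 30) * (1 - ((Fintype.card ν : ℝ) / 2 ^ 53 + 3 * (K : ℝ) / 2 ^ 53)) :=
          mul_le_mul_of_nonneg_left (by linarith) (by norm_num)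
      _ ≤ _ := mul_le_mul_of_nonneg_left hpq (by norm_num)
  have hc3 : (0 : ℝ) ≤ 1 - (Fintype.card ν : ℝ) / 2 ^ 53 := by linarith
  have key : (1 - 1 / 2 ^ 53) * ((1 + 1 / 2 ^ 30) * ((1 - (Fintype.card ν : ℝ) / 2 ^ 53)
      * ((1 - 3 * (K : ℝ) / 2 ^ 53) * ∑ b, |((limbMatVal L a b : ℤ) : ℝ)|))) ≤ rd w :=
    calc (1 - 1 / 2 ^ 53) * ((1 + 1 / 2 ^ 30) * ((1 - (Fintype.card ν : ℝ) / 2 ^ 53)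
          * ((1 - 3 * (K : ℝ) / 2 ^ 53) * ∑ b, |((limbMatVal L a b : ℤ) : ℝ)|)))
        ≤ (1 - 1 / 2 ^ 53) * ((1 + 1 / 2 ^ 30) * ((1 - (Fintype.card ν : ℝ) / 2 ^ 53)
          * ∑ b, absFloat rd L a b)) :=
          mul_le_mul_of_nonneg_left (mul_le_mul_of_nonneg_left
            (mul_le_mul_of_nonneg_left hSF hc3) (by norm_num)) (by norm_num)
      _ ≤ (1 - 1 / 2 ^ 53) * ((1 + 1 / 2 ^ 30) * (T a).rounded rd (absFloat rd L a)) :=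
          mul_le_mul_of_nonneg_left (mul_le_mul_of_nonneg_left hFR (by norm_num)) (by norm_num)
      _ ≤ (1 - 1 / 2 ^ 53) * ((1 + 1 / 2 ^ 30) * rowSumMax rd L T) :=
          mul_le_mul_of_nonneg_left (mul_le_mul_of_nonneg_left hRrs (by norm_num)) (by norm_num)
      _ = (1 - 1 / 2 ^ 53) * w := by rw [← hw]; ring
      _ ≤ rd w := hE
  have hSle : ∑ b, |((limbMatVal L a b : ℤ) : ℝ)| ≤ rd w := by
    refine le_trans ?_ key
    have := mul_le_mul_of_nonneg_left hprod hS0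
    calc ∑ b, |((limbMatVal L a b : ℤ) : ℝ)| = (∑ b, |((limbMatVal L a b : ℤ) : ℝ)|) * 1 := (mul_one _).symm
      _ ≤ (∑ b, |((limbMatVal L a b : ℤ) : ℝ)|) * ((1 - 1 / 2 ^ 53) * (1 + 1 / 2 ^ 30)
          * ((1 - (Fintype.card ν : ℝ) / 2 ^ 53) * (1 - 3 * (K : ℝ) / 2 ^ 53))) := this
      _ = _ := by ring
  have hfl : rd w < (⌊rd w⌋ : ℝ) + 1 := Int.lt_floor_add_one (rd w)
  linarith

/-- **The exact branch** (`K ≤ 2 ∧ n ≤ KMAX_INNER`: `return int(rs)`).  Under (A1) alone: with at most two limbs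
(top limb in `[−2^W, 2^W)`, lower limb in `[0, 2^W)`) every entry has modulus `≤ 2^40` and `to_float` is exact;
with `n ≤ 8192` leaves (`n·2^40 ≤ 2^53`) every row sum is exact in any bracketing (part 25
`EvalTree.rounded_eq_exact_of_int`); so `int(rs)` IS the maximum absolute row sum, in particular an upper bound. -/
theorem row_sum_le_maxAbsRowSumSmall {rd : ℝ → ℝ}
    (hint : ∀ z : ℤ, |z| ≤ 2 ^ 53 → rd (z : ℝ) = z)
    {K : ℕ} (hK : K ≤ 2) (L : Fin K → Matrix μ ν ℤ)
    (hlim : ∀ i a b, -2 ^ limbWidth ≤ L i a b ∧ L i a b < 2 ^ limbWidth)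
    (hlow : ∀ i : Fin K, (i : ℕ) + 1 < K → ∀ a b, 0 ≤ L i a b ∧ L i a b < 2 ^ limbWidth)
    (T : μ → EvalTree ν) (hT : ∀ a, (T a).leaves = Finset.univ.val) (hn : Fintype.card ν ≤ limbKMax)
    (a : μ) :
    ∑ b, |((limbMatVal L a b : ℤ) : ℝ)| ≤ (maxAbsRowSumSmall rd L T : ℝ) := by
  -- with ≤ 2 limbs `to_float` is exact and entries are ≤ 2^40
  have hent : ∀ a' b, hornerRd rd (fun i => L i a' b) = hornerExact (fun i => L i a' b) ∧
      |hornerExact (fun i => L i a' b)| ≤ 2 ^ 40 := by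
    intro a' b
    have hW : (2 : ℤ) ^ limbWidth = 2 ^ 20 := by norm_num [limbWidth]
    rcases K with _ | _ | _ | K
    · simp [hornerRd, hornerExact]
    · refine ⟨by simp [hornerRd, hornerExact], ?_⟩
      have h := hlim 0 a' b
      simp only [hornerExact, mul_zero, zero_add]
      rw [hW] at h
      exact abs_le.mpr ⟨by linarith [h.1], by linarith [h.2]⟩
    · have h1 := hlim 1 a' b
      have h0 := hlow 0 (by simp) a' b
      rw [hW] at h1 h0
      have hv : hornerExact (fun i => L i a' b) = 2 ^ limbWidth * L 1 a' b + L 0 a' b := by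
        simp [hornerExact, Fin.tail]
      have hX : |(2 ^ limbWidth * L 1 a' b : ℤ)| ≤ 2 ^ 53 := by
        rw [hW]; exact abs_le.mpr ⟨by linarith [h1.1], by linarith [h1.2]⟩
      have hvb : |2 ^ limbWidth * L 1 a' b + L 0 a' b| ≤ 2 ^ 40 := by
        rw [hW]; exact abs_le.mpr ⟨by linarith [h1.1, h0.1], by linarith [h1.2, h0.2]⟩
      refine ⟨?_, by rw [hv]; exact hvb⟩
      have e1 : hornerRd rd (fun i => L i a' b) = rd (rd (2 ^ limbWidth * (L 1 a' b : ℝ)) + (L 0 a' b : ℝ)) := by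
        simp [hornerRd, Fin.tail]
      have r1 : rd (2 ^ limbWidth * (L 1 a' b : ℝ)) = 2 ^ limbWidth * (L 1 a' b : ℝ) := by
        have := hint _ hX; push_cast at this; exact this
      have r2 : rd (2 ^ limbWidth * (L 1 a' b : ℝ) + (L 0 a' b : ℝ)) = 2 ^ limbWidth * (L 1 a' b : ℝ) + L 0 a' b := by
        have := hint _ (hvb.trans (by norm_num)); push_cast at this; exact this
      rw [e1, r1, r2, hv]; push_cast; ring
    · omega
  -- hence every row sum is exact (part 25), every value an integer cast
  have hfun : ∀ a', absFloat rd L a' = fun b => ((|limbMatVal L a' b| : ℤ) : ℝ) := fun a' => by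
    funext b; rw [absFloat, (hent a' b).1, limbMatVal_apply, Int.cast_abs]
  have hrowex : ∀ a', (T a').rounded rd (absFloat rd L a') = ((∑ b, |limbMatVal L a' b| : ℤ) : ℝ) := fun a' => by
    rw [hfun a']
    have hg : ∀ b, |(|limbMatVal L a' b|)| ≤ (2 : ℤ) ^ 40 := fun b => by
      rw [abs_abs, limbMatVal_apply]; exact (hent a' b).2
    have hc : (Multiset.card (T a').leaves : ℤ) * 2 ^ 40 ≤ 2 ^ 53 := by
      rw [hT a']
      have : (Fintype.card ν : ℤ) ≤ 8192 := by exact_mod_cast hn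
      simp only [Finset.card_val, Finset.card_univ]
      linarith
    rw [EvalTree.rounded_eq_exact_of_int hint (fun b => |limbMatVal L a' b|) (by norm_num) hg (T a') hc,
      EvalTree.exact_eq_sum _ (hT a')]
  obtain ⟨a₁, _, ha₁⟩ := Finset.exists_mem_eq_sup' Finset.univ_nonempty
    (fun a' => (T a').rounded rd (absFloat rd L a'))
  have hrs₁ : rowSumMax rd L T = ((∑ b, |limbMatVal L a₁ b| : ℤ) : ℝ) := ha₁.trans (hrowex a₁)
  have hle : (T a).rounded rd (absFloat rd L a) ≤ rowSumMax rd L T :=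
    Finset.le_sup' (fun a' => (T a').rounded rd (absFloat rd L a')) (Finset.mem_univ a)
  rw [hrowex a, hrs₁] at hle
  have hS : ∑ b, |((limbMatVal L a b : ℤ) : ℝ)| = ((∑ b, |limbMatVal L a b| : ℤ) : ℝ) := by push_cast; rfl
  rw [hS, maxAbsRowSumSmall, hrs₁, Int.floor_intCast]
  exact hle

end Summit.Ventures.CertifiedManyBodySolver.Upper.IntervalReader

end
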